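import Summits.Ventures.PercRepro.SixThreeGeneric
import Summits.Ventures.PercRepro.SixThreeTripleB

/-!
# PercRepro — the supply of a rank-`3` subset of a plane from `n` outside points (p2, gen 6)

mine-2 `MINE2-RLS.md` §19.6: on a plane `G` with `n` outside points `W` (`ρ(G ∪ W) ≥ 6`), every rank-`3` subset
`B ⊆ G` receives, from its `n` single-point witnesses and `C(n, 2)` pair witnesses alone,

    s(B) ≥ v(B, n) := n · w₁(B) + (2n − 3) · w₂(B) + C(n − 2, 2) · w₂⁻(B),

with the share lower bounds `w₁ = 6^{b−3}/(6^{b−3} + Λ)`, `w₂ = 6^{b−3}/(6^{b−3} + 2Λ + b)` (generic pairs, at least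
`2n − 3` of them by `card_generic_ge`) and `w₂⁻ = 6^{b−3}/(6^{b−3} + 6Λ + b)` (the remaining, `N`-parallel pairs).
This is the supply side of the planar inequalities `(I_t)` with `n = 6 − t` and `π_t = C(n − 2, 2) = 3, 1, 0`.
-/

namespace PercRepro

namespace SixThree

open Finset ThmH

variable {α : Type*} [DecidableEq α] {M : Matroid α} [M.Finite]

/-- The three share lower bounds of a rank-`3` set `B` (`b = |B|`, `Λ = Lam M B`). -/
noncomputable def w₁ (M : Matroid α) [M.Finite] (B : Finset α) : ℚ :=
  (6 : ℚ) ^ (B.card - 3) / ((6 : ℚ) ^ (B.card - 3) + Lam M B)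

/-- The generic-pair share lower bound. -/
noncomputable def w₂ (M : Matroid α) [M.Finite] (B : Finset α) : ℚ :=
  (6 : ℚ) ^ (B.card - 3) / ((6 : ℚ) ^ (B.card - 3) + 2 * Lam M B + B.card)

/-- The parallel-pair share lower bound: the exact `1/15` for a triple (`D_pair_le_triple`), the `Λ`-formula
`6^{b−3}/(6^{b−3} + 6Λ + b)` otherwise. -/
noncomputable def w₂m (M : Matroid α) [M.Finite] (B : Finset α) : ℚ :=
  if B.card = 3 then (1 / 15 : ℚ) else (6 : ℚ) ^ (B.card - 3) / ((6 : ℚ) ^ (B.card - 3) + 6 * Lam M B + B.card)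

/-- `v(B, n) = n · w₁ + (2n − 3) · w₂ + C(n − 2, 2) · w₂⁻`. -/
noncomputable def vSupply (M : Matroid α) [M.Finite] (B : Finset α) (n : ℕ) : ℚ :=
  n * w₁ M B + (2 * (n : ℚ) - 3) * w₂ M B + ((n - 2).choose 2 : ℕ) * w₂m M B

/-- `Λ(B) ≥ 0`. -/
theorem Lam_nonneg (M : Matroid α) [M.Finite] (B : Finset α) : 0 ≤ Lam M B :=
  Finset.sum_nonneg (fun _ _ => by positivity)

/-- `w₂⁻ ≤ w₂` for a rank-`3` set of the ground set (a triple has `Λ = 3`, `w₂ = 1/10 ≥ 1/15`). -/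
theorem w₂m_le_w₂ (hs : Simple M) {B : Finset α} (hB : B ⊆ gr M) (hrB : M.eRk (B : Set α) = 3) :
    w₂m M B ≤ w₂ M B := by
  unfold w₂m w₂
  have hΛ := Lam_nonneg M B
  by_cases h3 : B.card = 3
  · rw [if_pos h3, h3, Lam_triple hs hB hrB h3]
    norm_num
  · rw [if_neg h3]
    apply div_le_div_of_nonneg_left (by positivity) (by positivity)
    linarith

/-- `w₂⁻ ≥ 0`. -/
theorem w₂m_nonneg (M : Matroid α) [M.Finite] (B : Finset α) : 0 ≤ w₂m M B := by
  unfold w₂m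
  split_ifs
  · norm_num
  · have hΛ := Lam_nonneg M B
    have h1 : (0 : ℚ) ≤ (6 : ℚ) ^ (B.card - 3) := by positivity
    have h2 : (0 : ℚ) ≤ (B.card : ℚ) := by positivity
    exact div_nonneg h1 (by linarith)

/-- The single-point share of `B ∪ {x}` is at least `w₁(B)`. -/
theorem share_single_ge_w₁ (hs : Simple M) {G B : Finset α} (hG : G ∈ planes M) (hB : B ⊆ G)
    (hrB : M.eRk (B : Set α) = 3) {x : α} (hx : x ∈ gr M) (hxG : x ∉ G) :
    w₁ M B ≤ fRule M G (insert x B) / D M (insert x B) := by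
  have hSG : (insert x B) ∩ G = B := by
    ext y
    rw [Finset.mem_inter, Finset.mem_insert]
    constructor
    · rintro ⟨rfl | hyB, hyG⟩
      · exact absurd hyG hxG
      · exact hyB
    · intro hyB
      exact ⟨Or.inr hyB, hB hyB⟩
  rw [fRule_eq_of_inter hSG hrB]
  obtain ⟨-, hDpos⟩ := D_pos hG hSG hrB
  have hD := D_single_le hs hG hB hrB hx hxG
  unfold w₁
  apply div_le_div_of_nonneg_left (by positivity) hDpos hD

/-- The pair share of `B ∪ {x, x′}` is at least `w₂⁻(B)`, and at least `w₂(B)` when `ρ(G ∪ {x, x′}) = 5`. -/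
theorem share_pair_ge_w (hs : Simple M) {G B : Finset α} (hG : G ∈ planes M) (hB : B ⊆ G)
    (hrB : M.eRk (B : Set α) = 3) {x x' : α} (hx : x ∈ gr M) (hx' : x' ∈ gr M) (hxx' : x ≠ x')
    (hxG : x ∉ G) (hx'G : x' ∉ G) :
    w₂m M B ≤ fRule M G (insert x (insert x' B)) / D M (insert x (insert x' B)) ∧
    (M.eRk ((G ∪ {x, x'} : Finset α) : Set α) = 5 →
      w₂ M B ≤ fRule M G (insert x (insert x' B)) / D M (insert x (insert x' B))) := by
  have hSG := pair_inter_eq hB hxG hx'G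
  rw [fRule_eq_of_inter hSG hrB]
  obtain ⟨-, hDpos⟩ := D_pos hG hSG hrB
  refine ⟨?_, ?_⟩
  · unfold w₂m
    by_cases h3 : B.card = 3
    · rw [if_pos h3, ← fRule_eq_of_inter hSG hrB]
      exact share_triple_pair_ge hs hG hB hrB h3 hx hx' hxx' hxG hx'G
    · rw [if_neg h3]
      have hD := D_pair_le hs hG hB hrB hx hx' hxx' hxG hx'G
      apply div_le_div_of_nonneg_left (by positivity) hDpos hD
  · intro hr5
    -- `ρ(B ∪ {x, x′}) = ρ(G ∪ {x, x′}) = 5` since `cl(B) = G`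
    have hcl := closure_eq_of_subset_plane hG hB hrB
    have hr5' : M.eRk ((insert x (insert x' B) : Finset α) : Set α) = 5 := by
      apply le_antisymm
      · have := eRk_pair_insert_le (M := M) B x x'
        rw [hrB] at this
        exact this.trans (by norm_num)
      · rw [← hr5]
        have hsub : ((G ∪ {x, x'} : Finset α) : Set α) ⊆ M.closure ((insert x (insert x' B) : Finset α) : Set α) := by
          push_cast
          intro y hy
          simp only [Set.mem_union, Set.mem_insert_iff, Set.mem_singleton_iff] at hy
          rcases hy with hyG | rfl | rfl
          · have : (y : α) ∈ M.closure (B : Set α) := by rw [hcl]; exact_mod_cast hyG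
            exact M.closure_subset_closure (by
              intro z hz; simp only [Set.mem_insert_iff]; exact Or.inr (Or.inr hz)) this
          · exact M.subset_closure _ (by
              rw [← coe_gr M]
              exact_mod_cast Finset.insert_subset hx (Finset.insert_subset hx' (hB.trans (mem_planes.1 hG).1)))
              (by simp)
          · exact M.subset_closure _ (by
              rw [← coe_gr M]
              exact_mod_cast Finset.insert_subset hx (Finset.insert_subset hx' (hB.trans (mem_planes.1 hG).1)))
              (by simp)
        calc M.eRk ((G ∪ {x, x'} : Finset α) : Set α)
            ≤ M.eRk (M.closure ((insert x (insert x' B) : Finset α) : Set α)) := M.eRk_mono hsub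
          _ = M.eRk ((insert x (insert x' B) : Finset α) : Set α) := M.eRk_closure_eq _
    have hD := D_pair_le_generic hs hG hB hrB hx hx' hxx' hxG hx'G hr5'
    unfold w₂
    apply div_le_div_of_nonneg_left (by positivity) hDpos hD

/-- `C(n, 2) = (2n − 3) + C(n − 2, 2)` for `n ≥ 3`. -/
theorem choose_two_split {n : ℕ} (hn : 3 ≤ n) : n.choose 2 = (2 * n - 3) + (n - 2).choose 2 := by
  obtain ⟨m, rfl⟩ : ∃ m, n = m + 2 := ⟨n - 2, by omega⟩
  rw [show m + 2 - 2 = m by omega, choose_two_succ, choose_two_succ]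
  omega

/-- **The supply of `B` from `n` outside points** (mine-2 §19.6, the supply side of `(I_t)`): `G` a plane,
`B ⊆ G` of rank `3`, `W` a set of `n ≥ 3` points of the ground set outside `G` with `ρ(G ∪ W) ≥ 6`, and `Y` a family
containing every set of rank `4` or `5`; then `Σ_{S ∈ Y, S ∩ G = B} w(G, S) ≥ v(B, n)`. -/
theorem supply_ge_vSupply (hs : Simple M) {G B W : Finset α} (hG : G ∈ planes M) (hB : B ⊆ G)
    (hrB : M.eRk (B : Set α) = 3) (hW : W ⊆ gr M) (hWG : Disjoint W G) (hn : 3 ≤ W.card)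
    (hrW : (6 : ℕ∞) ≤ M.eRk ((G ∪ W : Finset α) : Set α)) (Y : Finset (Finset α))
    (hY : ∀ S, S ⊆ gr M → (3 : ℕ∞) < M.eRk (S : Set α) → M.eRk (S : Set α) < 6 → S ∈ Y) :
    vSupply M B W.card ≤ ∑ S ∈ Y.filter (fun S => S ∩ G = B), fRule M G S / D M S := by
  classical
  have hBg : B ⊆ gr M := hB.trans (mem_planes.1 hG).1
  have hWB : ∀ x ∈ W, x ∉ B := fun x hx hxB => Finset.disjoint_left.1 hWG hx (hB hxB)
  have hWG' : ∀ x ∈ W, x ∉ G := fun x hx => Finset.disjoint_left.1 hWG hx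
  -- the single-point witnesses
  set T₁ := W.image (fun x => insert x B) with hT₁
  have hinj₁ : Set.InjOn (fun x => insert x B) (W : Set α) := by
    intro x hx x' hx' h
    simp only at h
    have : x ∈ insert x' B := by rw [← h]; exact Finset.mem_insert_self _ _
    rw [Finset.mem_insert] at this
    rcases this with rfl | hxB
    · rfl
    · exact absurd hxB (hWB x hx)
  have hT₁sub : T₁ ⊆ Y.filter (fun S => S ∩ G = B) := by
    intro S hS
    rw [hT₁, Finset.mem_image] at hS
    obtain ⟨x, hx, rfl⟩ := hS
    rw [Finset.mem_filter]
    have hr4 := eRk_insert_eq_four hG hB hrB (hW hx) (hWG' x hx)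
    refine ⟨hY _ (Finset.insert_subset (hW hx) hBg) (by rw [hr4]; decide) (by rw [hr4]; decide), ?_⟩
    ext y
    rw [Finset.mem_inter, Finset.mem_insert]
    constructor
    · rintro ⟨rfl | hyB, hyG⟩
      · exact absurd hyG (hWG' y hx)
      · exact hyB
    · intro hyB
      exact ⟨Or.inr hyB, hB hyB⟩
  have hsum₁ : (W.card : ℚ) * w₁ M B ≤ ∑ S ∈ T₁, fRule M G S / D M S := by
    rw [hT₁, Finset.sum_image hinj₁]
    calc (W.card : ℚ) * w₁ M B = ∑ _x ∈ W, w₁ M B := by rw [Finset.sum_const, nsmul_eq_mul]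
      _ ≤ ∑ x ∈ W, fRule M G (insert x B) / D M (insert x B) :=
          Finset.sum_le_sum (fun x hx => share_single_ge_w₁ hs hG hB hrB (hW hx) (hWG' x hx))
  -- the pair witnesses
  set T₂ := (W.powersetCard 2).image (fun X => X ∪ B) with hT₂
  have hinj₂ : Set.InjOn (fun X => X ∪ B) ((W.powersetCard 2 : Finset (Finset α)) : Set (Finset α)) := by
    intro X hX X' hX' h
    simp only [Finset.mem_coe, Finset.mem_powersetCard] at hX hX'
    simp only at h
    have hXB : Disjoint X B := Finset.disjoint_of_subset_left hX.1 hWG |>.mono_right hB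
    have hX'B : Disjoint X' B := Finset.disjoint_of_subset_left hX'.1 hWG |>.mono_right hB
    rw [← Finset.union_sdiff_cancel_right hXB, ← Finset.union_sdiff_cancel_right hX'B, h]
  have hT₂sub : T₂ ⊆ Y.filter (fun S => S ∩ G = B) := by
    intro S hS
    rw [hT₂, Finset.mem_image] at hS
    obtain ⟨X, hX, rfl⟩ := hS
    rw [Finset.mem_powersetCard] at hX
    obtain ⟨x, x', hxx', rfl⟩ := Finset.card_eq_two.1 hX.2
    have hx : x ∈ W := hX.1 (by simp)
    have hx' : x' ∈ W := hX.1 (by simp)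
    rw [pair_union_eq, Finset.mem_filter]
    have hr4 := eRk_insert_eq_four hG hB hrB (hW hx') (hWG' x' hx')
    have hge : (4 : ℕ∞) ≤ M.eRk ((insert x (insert x' B) : Finset α) : Set α) := by
      rw [← hr4]
      exact M.eRk_mono (Finset.coe_subset.2 (Finset.subset_insert _ _))
    have hle : M.eRk ((insert x (insert x' B) : Finset α) : Set α) ≤ 5 := by
      have := eRk_pair_insert_le (M := M) B x x'
      rw [hrB] at this
      exact this.trans (by norm_num)
    refine ⟨hY _ (Finset.insert_subset (hW hx) (Finset.insert_subset (hW hx') hBg))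
      (lt_of_lt_of_le (by decide) hge) (lt_of_le_of_lt hle (by decide)), pair_inter_eq hB (hWG' x hx) (hWG' x' hx')⟩
  -- per pair: `≥ w₂⁻`, and `≥ w₂` for a generic pair
  have hpair : ∀ X ∈ W.powersetCard 2, w₂m M B ≤ fRule M G (X ∪ B) / D M (X ∪ B) ∧
      (M.eRk ((G ∪ X : Finset α) : Set α) = 5 → w₂ M B ≤ fRule M G (X ∪ B) / D M (X ∪ B)) := by
    intro X hX
    rw [Finset.mem_powersetCard] at hX
    obtain ⟨x, x', hxx', rfl⟩ := Finset.card_eq_two.1 hX.2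
    have hx : x ∈ W := hX.1 (by simp)
    have hx' : x' ∈ W := hX.1 (by simp)
    rw [pair_union_eq]
    exact share_pair_ge_w hs hG hB hrB (hW hx) (hW hx') hxx' (hWG' x hx) (hWG' x' hx')
  have hgen := card_generic_ge hG hW hWG hrW
  have hsum₂ : (2 * (W.card : ℚ) - 3) * w₂ M B + (((W.card - 2).choose 2 : ℕ) : ℚ) * w₂m M B ≤
      ∑ S ∈ T₂, fRule M G S / D M S := by
    rw [hT₂, Finset.sum_image hinj₂,
      ← Finset.sum_filter_add_sum_filter_not (W.powersetCard 2)
        (fun X => M.eRk ((G ∪ X : Finset α) : Set α) = 5)]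
    have hA : ((genericPairs M G W).card : ℚ) * w₂ M B ≤
        ∑ X ∈ (W.powersetCard 2).filter (fun X => M.eRk ((G ∪ X : Finset α) : Set α) = 5),
          fRule M G (X ∪ B) / D M (X ∪ B) := by
      unfold genericPairs
      rw [← nsmul_eq_mul, ← Finset.sum_const]
      apply Finset.sum_le_sum
      intro X hX
      rw [Finset.mem_filter] at hX
      exact (hpair X hX.1).2 hX.2
    have hBc : (((W.powersetCard 2).filter (fun X => ¬ M.eRk ((G ∪ X : Finset α) : Set α) = 5)).card : ℚ) *
        w₂m M B ≤
        ∑ X ∈ (W.powersetCard 2).filter (fun X => ¬ M.eRk ((G ∪ X : Finset α) : Set α) = 5),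
          fRule M G (X ∪ B) / D M (X ∪ B) := by
      rw [← nsmul_eq_mul, ← Finset.sum_const]
      apply Finset.sum_le_sum
      intro X hX
      rw [Finset.mem_filter] at hX
      exact (hpair X hX.1).1
    have hcount := Finset.card_filter_add_card_filter_not (s := W.powersetCard 2)
      (p := fun X => M.eRk ((G ∪ X : Finset α) : Set α) = 5)
    rw [Finset.card_powersetCard, choose_two_split hn] at hcount
    have hg : (genericPairs M G W).card = ((W.powersetCard 2).filter
        (fun X => M.eRk ((G ∪ X : Finset α) : Set α) = 5)).card := rfl
    rw [hg] at hgen hA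
    set g := ((W.powersetCard 2).filter (fun X => M.eRk ((G ∪ X : Finset α) : Set α) = 5)).card with hgdef
    set g' := ((W.powersetCard 2).filter (fun X => ¬ M.eRk ((G ∪ X : Finset α) : Set α) = 5)).card with hg'def
    have hw := w₂m_le_w₂ hs hBg hrB
    have hw0 : 0 ≤ w₂m M B := w₂m_nonneg M B
    have hgq : (2 * (W.card : ℚ) - 3) ≤ (g : ℚ) := by
      have : 2 * W.card ≤ g + 3 := hgen
      have : ((2 * W.card : ℕ) : ℚ) ≤ ((g + 3 : ℕ) : ℚ) := by exact_mod_cast this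
      push_cast at this
      linarith
    have hcq : (g : ℚ) + (g' : ℚ) = (2 * (W.card : ℚ) - 3) + (((W.card - 2).choose 2 : ℕ) : ℚ) := by
      have h3 : 3 ≤ 2 * W.card := by omega
      have : ((g + g' : ℕ) : ℚ) = (((2 * W.card - 3) + (W.card - 2).choose 2 : ℕ) : ℚ) := by rw [hcount]
      push_cast [Nat.cast_sub h3] at this
      linarith
    nlinarith [hA, hBc, mul_le_mul_of_nonneg_right hgq (sub_nonneg.2 hw)]
  -- the two families are disjoint (sizes `|B| + 1` and `|B| + 2`)
  have hdisj : Disjoint T₁ T₂ := by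
    rw [Finset.disjoint_left]
    intro S hS₁ hS₂
    rw [hT₁, Finset.mem_image] at hS₁
    rw [hT₂, Finset.mem_image] at hS₂
    obtain ⟨x, hx, rfl⟩ := hS₁
    obtain ⟨X, hX, hXS⟩ := hS₂
    rw [Finset.mem_powersetCard] at hX
    have hXB : Disjoint X B := Finset.disjoint_of_subset_left hX.1 hWG |>.mono_right hB
    have hc1 : (insert x B).card = B.card + 1 := Finset.card_insert_of_notMem (hWB x hx)
    have hc2 : (X ∪ B).card = B.card + 2 := by
      rw [Finset.card_union_of_disjoint hXB, hX.2]; ring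
    rw [← hXS] at hc1
    omega
  unfold vSupply
  calc (W.card : ℚ) * w₁ M B + (2 * (W.card : ℚ) - 3) * w₂ M B + (((W.card - 2).choose 2 : ℕ) : ℚ) * w₂m M B
      ≤ ∑ S ∈ T₁, fRule M G S / D M S + ∑ S ∈ T₂, fRule M G S / D M S := by
        rw [add_assoc]; exact add_le_add hsum₁ hsum₂
    _ = ∑ S ∈ T₁ ∪ T₂, fRule M G S / D M S := (Finset.sum_union hdisj).symm
    _ ≤ ∑ S ∈ Y.filter (fun S => S ∩ G = B), fRule M G S / D M S := by
        apply Finset.sum_le_sum_of_subset_of_nonneg (Finset.union_subset hT₁sub hT₂sub)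
        intro S _ _
        exact div_nonneg (fRule_nonneg M G S) (D_nonneg M S)

end SixThree

end PercRepro
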